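import Mathlib
import Summits.NavierStokesRegularity.NavierStokesRegularity.Theorems.EulerZoomLiouvillePowerGaugeEulerLiouvilleAnchoredBudgetBookkeeping
import Summits.NavierStokesRegularity.NavierStokesRegularity.Theorems.EulerZoomLiouvillePowerGaugeEulerLiouvilleCasimirFloorEndgameTools
import Summits.NavierStokesRegularity.NavierStokesRegularity.Theorems.EulerZoomLiouvillePowerGaugeEulerLiouvilleSwirlCapacityEndgame
import Literature.Analysis.FluidPDE.VorticityCalculus
import HarnessLib

/-!
# Crux `EulerZoomLiouville.PowerGaugeEulerLiouville` (stmt-NavierStokesRegularity-19832), line `anchored-budget`, stub C2 — part 3: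
# ANCHORED STARVATION (the bulk-window race; `Sig.stub_anchoredStarvation` BY NAME)

Route `EulerZoomLiouville` (NavierStokesRegularity), crux E.  Line `anchored-budget` (ideator ns-idea-11 g4;
`Cruxes/PowerGaugeEulerLiouville/Lines/anchored_budget.lean`), stub C2 `stub_anchoredStarvation` (split of 2026-08-28: C1 `stub_anchoredFloorTransport`
= ns-sfl-p1 g3, C2 = this seat).  GIVEN anchored floor blobs (the C1 conclusion `AnchoredFloorBlobs`, δ-unfolded verbatim as a hypothesis), a member of
the power-gauged class (`0 < ρ ≤ 1/2`) with a CLASSICAL far past `(−∞,T₁)` carrying a stretching budget `(K, Λ)`, `0 ≤ K < ρ/(1+ρ)`, has an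
IRROTATIONAL far past.

Proof (`anchoredStarvation`).  If `curl u(t₀) x₀ ≠ 0`, `t₀ < T₁ ≤ 0`: a blob `B = B(x₀,δ)` with `|curl u(t₀)| ≥ w > 0` (continuity); `Λ₁ := ∫_{(−∞,T₁)} Λ`,
`b := −t₀`, `m := |B|`.  Constants: the GNS eviction constant `C` and the cutoff constant `M` of part 1; `κ₀ := min 1 (m^{1/3}/(64 C² c (1+M²) + 1))`.
For a scale `a` (large) and every `t₁ ∈ (t₀ − κ₀ a^{1+ρ}, t₀)` part 2 gives an eviction budget `Φ` with `∫Φ ≤ m^{5/6} C √(κ₀a^{1+ρ}) √(4c(1+M²)a^{1−ρ})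
≤ a m/4` (`integral_budget_le`), so the anchored avatar `T ⊆ B(0,a)` of C1 has `|T| ≥ m/2` and carries `|curl u(t₁)|² ≥ w² e^{−2Λ₁} (b/(b+κ₀a^{1+ρ}))^{2K}`;
hence `∫_{−a²}^{0}∫_{B(0,a)} |curl u|² ≥ κ₀ a^{1+ρ} · (m/2) w² e^{−2Λ₁} (b/(b+κ₀a^{1+ρ}))^{2K} ≥ Cst · a^{(1+ρ)(1−2K)}` against the `E`-gauge
`≤ 16 c a^{1−ρ}` (`CasimirFloor.lintegral_window_sq_curl_le`): impossible for large `a` because `(1+ρ)(1−2K) > 1−ρ ⇔ K < ρ/(1+ρ)`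
(`SwirlCapacity.eventually_dominates`).

* `anchoredStarvation` — `Sig.stub_anchoredStarvation` with `InClass`, `IsAnchorablePast`, `anchoredThreshold`, `HasStretchingBudget`, `AnchoredFloorBlobs`
  δ-unfolded (the line file is not importable); the line's `theorem stub_anchoredStarvation : Sig.stub_anchoredStarvation := anchoredStarvation` is `exact`.

WHAT THIS IS NOT: not NS regularity, not the crux E — a stratum lemma `--supports` stmt-19832 about a hypothetical Euler zoom-limit class (MODEL lattice;
C1, the residue C3, crux 19832 and NS regularity stay OPEN; nothing is wired into the lead's skeleton by this seat).
[cite: CaffarelliKohnNirenberg1982, §2; doi:10.1515/crelle.2008.016 (Crippa–De Lellis 2008), §2–3; MajdaBertozziCUP2002, §1.6]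
-/

noncomputable section

set_option linter.dupNamespace false

open MeasureTheory Set Filter Topology Metric Function
open scoped NNReal ENNReal RealInnerProductSpace

namespace Summit.NavierStokesRegularity.NavierStokesRegularity.Theorems.PowerGaugeEulerLiouville.AnchoredBudget

open Literature.Analysis Literature.Analysis.FluidPDE
open Summit.NavierStokesRegularity.NavierStokesRegularity.Theorems.PowerGaugeEulerLiouville.CasimirFloor (lintegral_window_sq_curl_le)
open Summit.NavierStokesRegularity.NavierStokesRegularity.Theorems.PowerGaugeEulerLiouville.SwirlCapacity (eventually_dominates)
open Summit.NavierStokesRegularity.NavierStokesRegularity.Theorems.PowerGaugeEulerLiouville.SwirlfreeLedger (continuousOn_curl_slab)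

/-! ### Real arithmetic of the race -/

/-- For `0 < b ≤ y` and `e ≥ 0`: `(b/2)^e · y^{−e} ≤ (b/(b+y))^e`. [folklore] -/
theorem ratio_rpow_ge {b y e : ℝ} (hb : 0 < b) (hby : b ≤ y) (he : 0 ≤ e) :
    (b / 2) ^ e * y ^ (-e) ≤ (b / (b + y)) ^ e := by
  have hy : 0 < y := hb.trans_le hby
  rw [Real.rpow_neg hy.le, ← Real.inv_rpow hy.le, ← Real.mul_rpow (by positivity) (by positivity)]
  refine Real.rpow_le_rpow (by positivity) ?_ he
  rw [← div_eq_mul_inv, div_div, div_le_div_iff₀ (by positivity) (by positivity)]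
  nlinarith

/-- The bulk window fits under the parabolic one: for `a ≥ (b+1)²`, `a ≥ 1`, `0 ≤ κ₀ ≤ 1`, `0 < ρ ≤ 1/2`, `b ≥ 0`:
`κ₀ a^{1+ρ} + b ≤ a²`. [folklore] -/
theorem window_fits {a b κ₀ ρ : ℝ} (ha1 : 1 ≤ a) (hab : (b + 1) ^ 2 ≤ a) (hb : 0 ≤ b) (hκ0 : 0 ≤ κ₀) (hκ1 : κ₀ ≤ 1)
    (hρ : 0 < ρ) (hρ2 : ρ ≤ 1 / 2) : κ₀ * a ^ (1 + ρ) + b ≤ a ^ 2 := by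
  have ha0 : 0 < a := by linarith
  set r : ℝ := Real.sqrt a with hr
  have hr0 : 0 ≤ r := Real.sqrt_nonneg a
  have hrr : r * r = a := Real.mul_self_sqrt ha0.le
  have hbr : b + 1 ≤ r := by
    rw [hr, ← Real.sqrt_sq (by linarith : 0 ≤ b + 1)]
    exact Real.sqrt_le_sqrt hab
  have hpow : a ^ (1 + ρ) ≤ a * r := by
    calc a ^ (1 + ρ) ≤ a ^ (1 + 1 / 2 : ℝ) := Real.rpow_le_rpow_of_exponent_le ha1 (by linarith)
      _ = a * r := by rw [Real.rpow_add ha0, Real.rpow_one, hr, Real.sqrt_eq_rpow]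
  have har : 1 ≤ a * r := by nlinarith
  nlinarith [mul_nonneg hκ0 (Real.rpow_nonneg ha0.le (1 + ρ)), mul_le_mul_of_nonneg_left hbr (by positivity : 0 ≤ a * r)]

/-- The budget bound on the bulk window is linear in `a`: for `a ≥ 1`, `0 ≤ κ₀ ≤ 1`, `0 ≤ S ≤ κ₀ a^{1+ρ}`, `0 < ρ ≤ 1/2`, `c ≥ 0`:
`√S · √(2c(2a)^{1−ρ} + 2(M/a)² S c (2a)^{1−2ρ}) ≤ √(4c(1+M²)κ₀) · a`. [folklore] -/
theorem budget_linear {a κ₀ ρ S c M : ℝ} (ha1 : 1 ≤ a) (hκ0 : 0 ≤ κ₀) (hκ1 : κ₀ ≤ 1) (hS0 : 0 ≤ S) (hS : S ≤ κ₀ * a ^ (1 + ρ))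
    (hρ : 0 < ρ) (hρ2 : ρ ≤ 1 / 2) (hc : 0 ≤ c) :
    Real.sqrt S * Real.sqrt (2 * (c * (2 * a) ^ (1 - ρ)) + 2 * (M / a) ^ 2 * S * (c * (2 * a) ^ (1 - 2 * ρ))) ≤
      Real.sqrt (4 * c * (1 + M ^ 2) * κ₀) * a := by
  have ha0 : 0 < a := by linarith
  have hpow1 : (2 * a) ^ (1 - ρ) ≤ 2 * a ^ (1 - ρ) := by
    rw [Real.mul_rpow (by norm_num) ha0.le]
    gcongr
    calc (2 : ℝ) ^ (1 - ρ) ≤ 2 ^ (1 : ℝ) := Real.rpow_le_rpow_of_exponent_le (by norm_num) (by linarith)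
      _ = 2 := Real.rpow_one 2
  have hpow2 : (2 * a) ^ (1 - 2 * ρ) ≤ 2 * a ^ (1 - ρ) := by
    rw [Real.mul_rpow (by norm_num) ha0.le]
    have h2 : (2 : ℝ) ^ (1 - 2 * ρ) ≤ 2 := by
      calc (2 : ℝ) ^ (1 - 2 * ρ) ≤ 2 ^ (1 : ℝ) := Real.rpow_le_rpow_of_exponent_le (by norm_num) (by linarith)
        _ = 2 := Real.rpow_one 2
    have h3 : a ^ (1 - 2 * ρ) ≤ a ^ (1 - ρ) := Real.rpow_le_rpow_of_exponent_le ha1 (by linarith)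
    exact mul_le_mul h2 h3 (Real.rpow_nonneg ha0.le _) (by norm_num)
  have hS2 : S ≤ κ₀ * a ^ 2 := by
    refine hS.trans (mul_le_mul_of_nonneg_left ?_ hκ0)
    calc a ^ (1 + ρ) ≤ a ^ (2 : ℝ) := Real.rpow_le_rpow_of_exponent_le ha1 (by linarith)
      _ = a ^ 2 := Real.rpow_two a
  have hMS : (M / a) ^ 2 * S ≤ M ^ 2 := by
    have e : (M / a) ^ 2 * (κ₀ * a ^ 2) = M ^ 2 * κ₀ := by
      field_simp
    calc (M / a) ^ 2 * S ≤ (M / a) ^ 2 * (κ₀ * a ^ 2) := mul_le_mul_of_nonneg_left hS2 (sq_nonneg _)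
      _ = M ^ 2 * κ₀ := e
      _ ≤ M ^ 2 * 1 := mul_le_mul_of_nonneg_left hκ1 (sq_nonneg _)
      _ = M ^ 2 := mul_one _
  have ha1ρ : 0 ≤ a ^ (1 - ρ) := Real.rpow_nonneg ha0.le _
  have hQ : 2 * (c * (2 * a) ^ (1 - ρ)) + 2 * (M / a) ^ 2 * S * (c * (2 * a) ^ (1 - 2 * ρ)) ≤ 4 * c * (1 + M ^ 2) * a ^ (1 - ρ) := by
    have h1 : 2 * (c * (2 * a) ^ (1 - ρ)) ≤ 4 * c * a ^ (1 - ρ) := by nlinarith [mul_le_mul_of_nonneg_left hpow1 hc]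
    have h2 : 2 * (M / a) ^ 2 * S * (c * (2 * a) ^ (1 - 2 * ρ)) ≤ 4 * c * M ^ 2 * a ^ (1 - ρ) := by
      have hx : 0 ≤ (M / a) ^ 2 * S := mul_nonneg (sq_nonneg _) hS0
      have hy : c * (2 * a) ^ (1 - 2 * ρ) ≤ c * (2 * a ^ (1 - ρ)) := mul_le_mul_of_nonneg_left hpow2 hc
      calc 2 * (M / a) ^ 2 * S * (c * (2 * a) ^ (1 - 2 * ρ)) = 2 * ((M / a) ^ 2 * S) * (c * (2 * a) ^ (1 - 2 * ρ)) := by ring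
        _ ≤ 2 * M ^ 2 * (c * (2 * a ^ (1 - ρ))) := by gcongr
        _ = 4 * c * M ^ 2 * a ^ (1 - ρ) := by ring
    nlinarith
  have hSa : S ≤ κ₀ * a ^ (1 + ρ) := hS
  calc Real.sqrt S * Real.sqrt (2 * (c * (2 * a) ^ (1 - ρ)) + 2 * (M / a) ^ 2 * S * (c * (2 * a) ^ (1 - 2 * ρ)))
      ≤ Real.sqrt (κ₀ * a ^ (1 + ρ)) * Real.sqrt (4 * c * (1 + M ^ 2) * a ^ (1 - ρ)) := by
        gcongr
    _ = Real.sqrt (4 * c * (1 + M ^ 2) * κ₀ * (a ^ (1 + ρ) * a ^ (1 - ρ))) := by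
        rw [← Real.sqrt_mul (by positivity)]
        congr 1
        ring
    _ = Real.sqrt (4 * c * (1 + M ^ 2) * κ₀) * a := by
        rw [← Real.rpow_add ha0, show (1 + ρ + (1 - ρ) : ℝ) = 2 by ring, Real.rpow_two, Real.sqrt_mul (by positivity),
          Real.sqrt_sq ha0.le]

/-- The choice of `κ₀`: with `κ₀ ≤ m^{1/3}/(64 C² c (1+M²) + 1)`, `m ≥ 0`: `m^{5/6} · C · √(4c(1+M²)κ₀) ≤ m/4`. [folklore] -/
theorem kappa_choice {m C c M κ₀ : ℝ} (hm : 0 ≤ m) (hC : 0 ≤ C) (hc : 0 ≤ c)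
    (hκ : κ₀ ≤ m ^ (1 / 3 : ℝ) / (64 * C ^ 2 * c * (1 + M ^ 2) + 1)) :
    m ^ (5 / 6 : ℝ) * C * Real.sqrt (4 * c * (1 + M ^ 2) * κ₀) ≤ m / 4 := by
  have hD : 0 < 64 * C ^ 2 * c * (1 + M ^ 2) + 1 := by positivity
  have h1 : C ^ 2 * (4 * c * (1 + M ^ 2) * κ₀) ≤ m ^ (1 / 3 : ℝ) / 16 := by
    have := mul_le_mul_of_nonneg_left hκ (by positivity : 0 ≤ 4 * C ^ 2 * c * (1 + M ^ 2))
    rw [mul_div_assoc'] at this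
    calc C ^ 2 * (4 * c * (1 + M ^ 2) * κ₀) = 4 * C ^ 2 * c * (1 + M ^ 2) * κ₀ := by ring
      _ ≤ 4 * C ^ 2 * c * (1 + M ^ 2) * m ^ (1 / 3 : ℝ) / (64 * C ^ 2 * c * (1 + M ^ 2) + 1) := this
      _ ≤ m ^ (1 / 3 : ℝ) / 16 := by
          rw [div_le_div_iff₀ hD (by norm_num)]
          nlinarith [Real.rpow_nonneg hm (1 / 3 : ℝ), sq_nonneg C, sq_nonneg M]
  have h2 : C * Real.sqrt (4 * c * (1 + M ^ 2) * κ₀) ≤ m ^ (1 / 6 : ℝ) / 4 := by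
    rw [← Real.sqrt_sq hC, ← Real.sqrt_mul (sq_nonneg C)]
    calc Real.sqrt (C ^ 2 * (4 * c * (1 + M ^ 2) * κ₀)) ≤ Real.sqrt (m ^ (1 / 3 : ℝ) / 16) := Real.sqrt_le_sqrt h1
      _ = m ^ (1 / 6 : ℝ) / 4 := by
          rw [Real.sqrt_div (Real.rpow_nonneg hm _), show (16 : ℝ) = 4 ^ 2 by norm_num, Real.sqrt_sq (by norm_num),
            Real.sqrt_eq_rpow, ← Real.rpow_mul hm]
          norm_num
  calc m ^ (5 / 6 : ℝ) * C * Real.sqrt (4 * c * (1 + M ^ 2) * κ₀) = m ^ (5 / 6 : ℝ) * (C * Real.sqrt (4 * c * (1 + M ^ 2) * κ₀)) := by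
        ring
    _ ≤ m ^ (5 / 6 : ℝ) * (m ^ (1 / 6 : ℝ) / 4) := mul_le_mul_of_nonneg_left h2 (Real.rpow_nonneg hm _)
    _ = m / 4 := by
        rw [← mul_div_assoc, ← Real.rpow_add' hm (by norm_num)]
        norm_num

/-- **Budget on the bulk window.**  If `∫Φ ≤ m^{5/6} C √(t₀−t₁) √(2c(2a)^{1−ρ} + 2(M/a)²(t₀−t₁)c(2a)^{1−2ρ})` (part 2), `0 ≤ t₀ − t₁ ≤ κ₀ a^{1+ρ}`, `a ≥ 1`,
`κ₀ = min 1 (m^{1/3}/(64C²c(1+M²)+1))`-small, then `∫Φ/(a/2) ≤ m/2`. [folklore] -/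
theorem integral_budget_le {J m C c M κ₀ a ρ S : ℝ} (hm : 0 < m) (hC : 0 ≤ C) (hc : 0 ≤ c) (ha1 : 1 ≤ a) (hκ0 : 0 ≤ κ₀) (hκ1 : κ₀ ≤ 1)
    (hκ : κ₀ ≤ m ^ (1 / 3 : ℝ) / (64 * C ^ 2 * c * (1 + M ^ 2) + 1)) (hS0 : 0 ≤ S) (hS : S ≤ κ₀ * a ^ (1 + ρ))
    (hρ : 0 < ρ) (hρ2 : ρ ≤ 1 / 2)
    (hJ : J ≤ m ^ (5 / 6 : ℝ) * C * Real.sqrt S *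
      Real.sqrt (2 * (c * (2 * a) ^ (1 - ρ)) + 2 * (M / a) ^ 2 * S * (c * (2 * a) ^ (1 - 2 * ρ)))) :
    J / (a / 2) ≤ m / 2 := by
  have ha0 : 0 < a := by linarith
  have h1 := budget_linear (M := M) (c := c) ha1 hκ0 hκ1 hS0 hS hρ hρ2 hc
  have h2 := kappa_choice (M := M) hm.le hC hc hκ
  have h3 : J ≤ a * m / 4 := by
    calc J ≤ m ^ (5 / 6 : ℝ) * C * Real.sqrt S *
          Real.sqrt (2 * (c * (2 * a) ^ (1 - ρ)) + 2 * (M / a) ^ 2 * S * (c * (2 * a) ^ (1 - 2 * ρ))) := hJ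
      _ = m ^ (5 / 6 : ℝ) * C * (Real.sqrt S *
          Real.sqrt (2 * (c * (2 * a) ^ (1 - ρ)) + 2 * (M / a) ^ 2 * S * (c * (2 * a) ^ (1 - 2 * ρ)))) := by ring
      _ ≤ m ^ (5 / 6 : ℝ) * C * (Real.sqrt (4 * c * (1 + M ^ 2) * κ₀) * a) :=
          mul_le_mul_of_nonneg_left h1 (by positivity)
      _ = m ^ (5 / 6 : ℝ) * C * Real.sqrt (4 * c * (1 + M ^ 2) * κ₀) * a := by ring
      _ ≤ m / 4 * a := mul_le_mul_of_nonneg_right h2 ha0.le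
      _ = a * m / 4 := by ring
  rw [div_le_iff₀ (by positivity)]
  linarith

/-- **From an anchored avatar to the slice floor.**  If `m = m/2 + m/2 ≤ |T| + I` with `I ≤ m/2`, and on `T ⊆ B(0,a)` the vorticity obeys
`|curl v|² ≥ w² e^{−2L₂} r₂^{2K}` with `L₂ ≤ L₁`, `0 ≤ r₁ ≤ r₂`, `K ≥ 0`, then `∫_{B(0,a)} |curl v|² ≥ w² e^{−2L₁} r₁^{2K} · m/2`. [folklore] -/
theorem slice_floor_of_avatar {v : EuclideanSpace ℝ (Fin 3) → EuclideanSpace ℝ (Fin 3)} {T : Set (EuclideanSpace ℝ (Fin 3))}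
    {a w K r₁ r₂ L₁ L₂ mR I : ℝ} {m : ℝ≥0∞} (hTm : MeasurableSet T) (hTsub : T ⊆ ball (0 : EuclideanSpace ℝ (Fin 3)) a)
    (hvol : m ≤ volume T + ENNReal.ofReal I) (hmeq : m = ENNReal.ofReal (mR / 2) + ENNReal.ofReal (mR / 2)) (hI : I ≤ mR / 2)
    (hTfloor : ∀ x ∈ T, w ^ 2 * Real.exp (-(2 * L₂)) * r₂ ^ (2 * K) ≤ ‖curl v x‖ ^ 2) (hL : L₂ ≤ L₁) (hr : r₁ ≤ r₂)
    (hr₁ : 0 ≤ r₁) (hK : 0 ≤ K) :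
    ENNReal.ofReal (w ^ 2 * Real.exp (-(2 * L₁)) * r₁ ^ (2 * K) * (mR / 2)) ≤
      ∫⁻ x in ball (0 : EuclideanSpace ℝ (Fin 3)) a, ENNReal.ofReal (‖curl v x‖ ^ 2) := by
  set Fl : ℝ := w ^ 2 * Real.exp (-(2 * L₁)) * r₁ ^ (2 * K) with hFl
  have hFl0 : 0 ≤ Fl := by positivity
  -- `|T| ≥ m/2`
  have hT : ENNReal.ofReal (mR / 2) ≤ volume T := by
    have h1 : m ≤ volume T + ENNReal.ofReal (mR / 2) := hvol.trans (add_le_add le_rfl (ENNReal.ofReal_le_ofReal hI))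
    rw [hmeq] at h1
    exact (ENNReal.add_le_add_iff_right ENNReal.ofReal_ne_top).1 h1
  -- the floor on `T`
  have hFlle : ∀ x ∈ T, Fl ≤ ‖curl v x‖ ^ 2 := by
    intro x hx
    refine le_trans ?_ (hTfloor x hx)
    have he : Real.exp (-(2 * L₁)) ≤ Real.exp (-(2 * L₂)) := Real.exp_le_exp.2 (by linarith)
    have hrr : r₁ ^ (2 * K) ≤ r₂ ^ (2 * K) := Real.rpow_le_rpow hr₁ hr (by linarith)
    exact mul_le_mul (mul_le_mul_of_nonneg_left he (sq_nonneg _)) hrr (by positivity) (by positivity)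
  calc ENNReal.ofReal (Fl * (mR / 2)) = ENNReal.ofReal Fl * ENNReal.ofReal (mR / 2) := ENNReal.ofReal_mul hFl0
    _ ≤ ENNReal.ofReal Fl * volume T := by gcongr
    _ = ∫⁻ _ in T, ENNReal.ofReal Fl := (setLIntegral_const _ _).symm
    _ ≤ ∫⁻ x in T, ENNReal.ofReal (‖curl v x‖ ^ 2) := setLIntegral_mono' hTm fun x hx => ENNReal.ofReal_le_ofReal (hFlle x hx)
    _ ≤ ∫⁻ x in ball (0 : EuclideanSpace ℝ (Fin 3)) a, ENNReal.ofReal (‖curl v x‖ ^ 2) := lintegral_mono_set hTsub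

/-! ### The starvation endgame -/

/-- **ANCHORED STARVATION — `Sig.stub_anchoredStarvation` of the line `anchored-budget`, δ-unfolded.**  GIVEN anchored floor blobs (the conclusion of
C1 `stub_anchoredFloorTransport`), a member of Seregin's power-gauged ancient Euler class (`0 < ρ ≤ 1/2`) whose far past `(−∞,T₁)` is classical and carries a
stretching budget `(K, Λ)` with `0 ≤ K < ρ/(1+ρ)` is IRROTATIONAL on `(−∞,T₁)`.  The bulk-window race: the GNS eviction budget of the gauges (parts 1–2) anchors
half of every vorticity blob on the window `S_a = κ₀ a^{1+ρ}`, whose enstrophy `≳ a^{(1+ρ)(1−2K)}` beats the `E`-gauge `16 c a^{1−ρ}` iff `K < ρ/(1+ρ)`.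
[cite: CaffarelliKohnNirenberg1982, §2; doi:10.1515/crelle.2008.016, §2–3; MajdaBertozziCUP2002, §1.6] -/
theorem anchoredStarvation :
    ∀ ρ : ℝ, 0 < ρ → ρ ≤ 1 / 2 → ∀ (u : ℝ → EuclideanSpace ℝ (Fin 3) → EuclideanSpace ℝ (Fin 3))
      (p : ℝ → EuclideanSpace ℝ (Fin 3) → ℝ)
      (H : ℝ → EuclideanSpace ℝ (Fin 3) → EuclideanSpace ℝ (Fin 3) →L[ℝ] EuclideanSpace ℝ (Fin 3)) (c : ℝ≥0),
      (IsSuitableWeakSolutionOn (slab (EuclideanSpace ℝ (Fin 3)) (Set.Iio 0) isOpen_Iio) 0 0 u p ∧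
        HasWeakSpatialGradientOn (slab (EuclideanSpace ℝ (Fin 3)) (Set.Iio 0) isOpen_Iio) u H ∧
        (∀ a : ℝ, 0 < a →
          ENNReal.ofReal (a ^ (2 * ρ)) * cknA a (0 : ℝ × EuclideanSpace ℝ (Fin 3)) u +
              ENNReal.ofReal (a ^ ρ) * cknE a (0 : ℝ × EuclideanSpace ℝ (Fin 3)) H +
            ENNReal.ofReal (a ^ (2 * ρ)) * cknD a (0 : ℝ × EuclideanSpace ℝ (Fin 3)) p ≤ (c : ℝ≥0∞))) →
      ∀ (T₁ K : ℝ) (Λ : ℝ → ℝ), (IsClassicalEulerSolutionOn (Set.Iio 0) 0 u p ∧ T₁ ≤ 0) → 0 ≤ K →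
        K < ρ / (1 + ρ) →
        (IntegrableOn Λ (Set.Iio T₁) ∧ (∀ τ : ℝ, 0 ≤ Λ τ) ∧
          ∀ τ : ℝ, τ < T₁ → ∀ x : EuclideanSpace ℝ (Fin 3),
            ⟪fderiv ℝ (u τ) x (curl (u τ) x), curl (u τ) x⟫ ≤ (K / (-τ) + Λ τ) * ‖curl (u τ) x‖ ^ 2) →
        (∀ t₀ : ℝ, t₀ < T₁ → ∀ (x₀ : EuclideanSpace ℝ (Fin 3)) (δ w a : ℝ) (Φ : ℝ → ℝ), 0 < δ → 0 ≤ w → 0 < a →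
          ‖x₀‖ + δ ≤ a / 2 → (∀ x ∈ ball x₀ δ, w ≤ ‖curl (u t₀) x‖) →
          ∀ t₁ : ℝ, t₁ < t₀ → IntegrableOn Φ (Set.Icc t₁ t₀) → (∀ s ∈ Set.Icc t₁ t₀, 0 ≤ Φ s) →
            (∀ s ∈ Set.Icc t₁ t₀, ∀ E : Set (EuclideanSpace ℝ (Fin 3)), MeasurableSet E →
              E ⊆ ball (0 : EuclideanSpace ℝ (Fin 3)) a → volume E ≤ volume (ball x₀ δ) →
                ∫⁻ x in E, ‖u s x‖ₑ ≤ ENNReal.ofReal (Φ s)) →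
            ∃ T : Set (EuclideanSpace ℝ (Fin 3)), MeasurableSet T ∧ T ⊆ ball (0 : EuclideanSpace ℝ (Fin 3)) a ∧
              volume (ball x₀ δ) ≤ volume T + ENNReal.ofReal ((∫ s in Set.Icc t₁ t₀, Φ s) / (a / 2)) ∧
              ∀ x ∈ T, w ^ 2 * Real.exp (-(2 * ∫ s in Set.Ioo t₁ t₀, Λ s)) * ((-t₀) / (-t₁)) ^ (2 * K) ≤
                ‖curl (u t₁) x‖ ^ 2) →
        ∀ τ : ℝ, τ < T₁ → ∀ x : EuclideanSpace ℝ (Fin 3), curl (u τ) x = 0 := by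
  intro ρ hρ hρ2 u p H c hcls T₁ K Λ hanc hK0 hKlt hbud hblobs t₀ ht₀T x₀
  by_contra hne
  obtain ⟨_, hH, hG⟩ := hcls
  have hcl := hanc.1
  have ht₀ : t₀ < 0 := lt_of_lt_of_le ht₀T hanc.2
  have hA : ∀ a : ℝ, 0 < a →
      ENNReal.ofReal (a ^ (2 * ρ)) * cknA a (0 : ℝ × EuclideanSpace ℝ (Fin 3)) u ≤ (c : ℝ≥0∞) :=
    fun a ha => (le_add_right (le_add_right le_rfl)).trans (hG a ha)
  have hE : ∀ a : ℝ, 0 < a →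
      ENNReal.ofReal (a ^ ρ) * cknE a (0 : ℝ × EuclideanSpace ℝ (Fin 3)) H ≤ (c : ℝ≥0∞) :=
    fun a ha => (le_add_right (le_add_left le_rfl)).trans (hG a ha)
  -- (1) the blob
  set w : ℝ := ‖curl (u t₀) x₀‖ / 2 with hw
  have hw0 : 0 < w := by rw [hw]; exact half_pos (norm_pos_iff.2 hne)
  have hcont : Continuous (curl (u t₀)) := continuous_curl (contDiff_one_slice hcl ht₀)
  obtain ⟨δ, hδ0, hδ⟩ := Metric.continuous_iff.1 hcont x₀ w hw0
  have hfloor : ∀ x ∈ ball x₀ δ, w ≤ ‖curl (u t₀) x‖ := by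
    intro x hx
    have h := hδ x (mem_ball.1 hx)
    rw [dist_eq_norm] at h
    have := norm_sub_norm_le (curl (u t₀) x₀) (curl (u t₀) x)
    rw [← norm_neg, neg_sub] at h
    rw [hw] at h ⊢
    linarith
  set m : ℝ≥0∞ := volume (ball x₀ δ) with hm
  have hmtop : m ≠ ⊤ := measure_ball_lt_top.ne
  have hmpos : 0 < m := measure_ball_pos volume x₀ hδ0
  set mR : ℝ := m.toReal with hmR
  have hmR0 : 0 < mR := ENNReal.toReal_pos hmpos.ne' hmtop
  have hmeq : m = ENNReal.ofReal mR := (ENNReal.ofReal_toReal hmtop).symm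
  -- (2) the constants
  obtain ⟨C, hC⟩ := setLIntegral_enorm_le_of_hasCompactSupport
  obtain ⟨M, hM0, hcut⟩ := exists_cutoff
  obtain ⟨hΛi, hΛ0, -⟩ := hbud
  set Λ₁ : ℝ := ∫ s in Set.Iio T₁, Λ s with hΛ₁
  set b : ℝ := -t₀ with hb
  have hb0 : 0 < b := by rw [hb]; linarith
  set F₀ : ℝ := w ^ 2 * Real.exp (-(2 * Λ₁)) with hF₀
  have hF₀0 : 0 < F₀ := by positivity
  set κ₀ : ℝ := min 1 (mR ^ (1 / 3 : ℝ) / (64 * (C : ℝ) ^ 2 * c * (1 + M ^ 2) + 1)) with hκ₀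
  have hκ₀0 : 0 < κ₀ := lt_min one_pos (div_pos (Real.rpow_pos_of_pos hmR0 _) (by positivity))
  have hκ₀1 : κ₀ ≤ 1 := min_le_left _ _
  -- (3) the race exponents and the large scale
  set s : ℝ := (1 + ρ) * (1 - 2 * K) with hs
  have hes : 1 - ρ < s := by
    rw [hs]
    have h1 : K * (1 + ρ) < ρ := by rwa [lt_div_iff₀ (by linarith)] at hKlt
    linarith only [h1]
  set Cst : ℝ := κ₀ ^ (1 - 2 * K) * (F₀ * (b / 2) ^ (2 * K) * (mR / 2)) with hCst
  have hCst0 : 0 < Cst := by positivity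
  obtain ⟨A, hA1, hrace⟩ := eventually_dominates (e := 1 - ρ) (by linarith) hes hCst0 0 (16 * c) 0
  set a : ℝ := max (max A ((b + 1) ^ 2)) (max (2 * (‖x₀‖ + δ)) (b / κ₀)) with ha
  have haA : A ≤ a := le_trans (le_max_left _ _) (le_max_left _ _)
  have ha1 : 1 ≤ a := hA1.trans haA
  have ha0 : 0 < a := by linarith
  have hab : (b + 1) ^ 2 ≤ a := le_trans (le_max_right _ _) (le_max_left _ _)
  have hxa : ‖x₀‖ + δ ≤ a / 2 := by
    have : 2 * (‖x₀‖ + δ) ≤ a := le_trans (le_max_left _ _) (le_max_right _ _)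
    linarith
  have hbκ : b / κ₀ ≤ a := le_trans (le_max_right _ _) (le_max_right _ _)
  -- the bulk window `S_a = κ₀ a^{1+ρ}`
  set y : ℝ := κ₀ * a ^ (1 + ρ) with hy
  have hy0 : 0 < y := mul_pos hκ₀0 (Real.rpow_pos_of_pos ha0 _)
  have hby : b ≤ y := by
    have h1 : a ≤ a ^ (1 + ρ) := by
      calc a = a ^ (1 : ℝ) := (Real.rpow_one a).symm
        _ ≤ a ^ (1 + ρ) := Real.rpow_le_rpow_of_exponent_le ha1 (by linarith)
    have h2 : b ≤ κ₀ * a := by rwa [div_le_iff₀' hκ₀0] at hbκ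
    exact h2.trans (mul_le_mul_of_nonneg_left h1 hκ₀0.le)
  have hwin : y + b ≤ a ^ 2 := window_fits ha1 hab hb0.le hκ₀0.le hκ₀1 hρ hρ2
  -- (4) the per-slice floor on the bulk window
  have hslice : ∀ t₁ ∈ Ioo (t₀ - y) t₀,
      ENNReal.ofReal (w ^ 2 * Real.exp (-(2 * Λ₁)) * (b / (b + y)) ^ (2 * K) * (mR / 2)) ≤
        ∫⁻ x in ball (0 : EuclideanSpace ℝ (Fin 3)) a, ENNReal.ofReal (‖curl (u t₁) x‖ ^ 2) := by
    intro t₁ ht₁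
    have ht₁0 : t₁ < t₀ := ht₁.2
    have hwin₁ : -a ^ 2 ≤ t₁ := by rw [hb] at hwin; linarith [ht₁.1]
    -- the cutoff and the eviction budget of part 2
    obtain ⟨ψ, hψ, hψc, h0, h1, hone, hts, hMψ⟩ := hcut a ha0
    obtain ⟨Φ, hΦi, hΦ0, hΦev, hΦint⟩ :=
      exists_evictionBudget hH hcl hA hE hC ha0 hψ hψc h0 h1 hone hts hMψ ht₁0 ht₀ hwin₁ hmtop
    -- the anchored avatar of C1
    obtain ⟨T, hTm, hTsub, hvol, hTfloor⟩ :=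
      hblobs t₀ ht₀T x₀ δ w a Φ hδ0 hw0.le ha0 hxa hfloor t₁ ht₁0 hΦi hΦ0 hΦev
    -- `∫Φ/(a/2) ≤ m/2`
    have hbudget : (∫ s in Set.Icc t₁ t₀, Φ s) / (a / 2) ≤ mR / 2 :=
      integral_budget_le (M := M) hmR0 C.coe_nonneg c.coe_nonneg ha1 hκ₀0.le hκ₀1 (min_le_right _ _) (by linarith)
        (by rw [← hy]; linarith [ht₁.1]) hρ hρ2 hΦint
    have hmeq2 : m = ENNReal.ofReal (mR / 2) + ENNReal.ofReal (mR / 2) := by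
      rw [hmeq, ← ENNReal.ofReal_add (by positivity) (by positivity), add_halves]
    have hΛle : ∫ s in Set.Ioo t₁ t₀, Λ s ≤ Λ₁ :=
      setIntegral_mono_set hΛi (Eventually.of_forall hΛ0) (Eventually.of_forall fun s hs => lt_trans hs.2 ht₀T)
    have hratio : b / (b + y) ≤ (-t₀) / (-t₁) := by
      have hnt₁ : 0 < -t₁ := by linarith
      rw [hb, div_le_div_iff₀ (by linarith) hnt₁]
      exact mul_le_mul_of_nonneg_left (by linarith [ht₁.1]) (by linarith)
    exact slice_floor_of_avatar hTm hTsub hvol hmeq2 hbudget hTfloor hΛle hratio (by positivity) hK0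
  -- (5) the window integral against the `E`-gauge
  have hIoo : Ioo (t₀ - y) t₀ ⊆ Ioo (-a ^ 2) 0 := fun t ht => ⟨by rw [hb] at hwin; linarith [ht.1], ht.2.trans ht₀⟩
  set Fl : ℝ := w ^ 2 * Real.exp (-(2 * Λ₁)) * (b / (b + y)) ^ (2 * K) with hFl
  have hFl0 : 0 ≤ Fl := by positivity
  have hlow : ENNReal.ofReal (y * (Fl * (mR / 2))) ≤
      ∫⁻ τ in Ioo (-a ^ 2) 0, ∫⁻ x in ball (0 : EuclideanSpace ℝ (Fin 3)) a, ENNReal.ofReal (‖curl (u τ) x‖ ^ 2) := by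
    calc ENNReal.ofReal (y * (Fl * (mR / 2))) = ENNReal.ofReal (Fl * (mR / 2)) * volume (Ioo (t₀ - y) t₀) := by
          rw [Real.volume_Ioo, sub_sub_cancel, ENNReal.ofReal_mul hy0.le, mul_comm]
      _ = ∫⁻ _ in Ioo (t₀ - y) t₀, ENNReal.ofReal (Fl * (mR / 2)) := (setLIntegral_const _ _).symm
      _ ≤ ∫⁻ τ in Ioo (t₀ - y) t₀, ∫⁻ x in ball (0 : EuclideanSpace ℝ (Fin 3)) a, ENNReal.ofReal (‖curl (u τ) x‖ ^ 2) :=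
          setLIntegral_mono' measurableSet_Ioo fun τ hτ => hslice τ hτ
      _ ≤ _ := lintegral_mono_set hIoo
  have hup := lintegral_window_sq_curl_le hH hcl hE ha0
  have hreal : y * (Fl * (mR / 2)) ≤ 16 * ((c : ℝ) * a ^ (1 - ρ)) :=
    (ENNReal.ofReal_le_ofReal_iff (by positivity)).1 (hlow.trans hup)
  -- (6) the race `(1+ρ)(1−2K) > 1−ρ`
  have hlower : Cst * a ^ s ≤ y * (Fl * (mR / 2)) := by
    have h1 : (b / 2) ^ (2 * K) * y ^ (-(2 * K)) ≤ (b / (b + y)) ^ (2 * K) := ratio_rpow_ge hb0 hby (by linarith)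
    have h2 : y * y ^ (-(2 * K)) = κ₀ ^ (1 - 2 * K) * a ^ s := by
      have e1 : y * y ^ (-(2 * K)) = y ^ (1 - 2 * K) := by
        rw [show (1 - 2 * K : ℝ) = 1 + -(2 * K) by ring, Real.rpow_add hy0, Real.rpow_one]
      rw [e1, hy, Real.mul_rpow hκ₀0.le (Real.rpow_nonneg ha0.le _), ← Real.rpow_mul ha0.le, hs]
    calc Cst * a ^ s = (y * y ^ (-(2 * K))) * (F₀ * (b / 2) ^ (2 * K) * (mR / 2)) := by rw [h2, hCst]; ring
      _ = y * (F₀ * ((b / 2) ^ (2 * K) * y ^ (-(2 * K))) * (mR / 2)) := by ring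
      _ ≤ y * (F₀ * (b / (b + y)) ^ (2 * K) * (mR / 2)) := by gcongr
      _ = y * (Fl * (mR / 2)) := by rw [hFl, hF₀]
  have hfinal := hrace a haA
  simp only [zero_mul, zero_add, add_zero] at hfinal
  linarith only [hfinal, hlower, hreal]

end Summit.NavierStokesRegularity.NavierStokesRegularity.Theorems.PowerGaugeEulerLiouville.AnchoredBudget

end
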